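import Summits.RiemannHypothesis.RiemannHypothesis.Theorems.WeilFormatCPolyWindowMixedArchBounds
import Summits.RiemannHypothesis.RiemannHypothesis.Theorems.WeilFormatCMeanSquareGram
import Literature.NumberTheory.LFunctions.RiemannSiegelStirling
import HarnessLib

/-!
# Format C, design C∞: first-order asymptotics of the archimedean families `J_s(m)`, `J_c(m)` of the mixed entries

Route context: Fourier–Galerkin / Schur-complement certificates of Weil positivity on a window ("format C";
cell memo `run/shared/lean/pub/rh-explicit/rh-explicit-weil-10/KERNEL-LEVER.md` §19–§20, sizing note
`run/shared/lean/pub/rh-explicit/rh-explicit-weil-2/gen9/CINF-DOOR-SIZING.md` §3 item (iii); supporting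
stmt-RiemannHypothesis-0098; seat rh-explicit-weil-10).

The profile images `W(1x^q, χ_m)` of the C∞ door (`WeilFormatCPolyWindowMixedEntry`) carry two non-elementary
`m`-families, `J_s(m) = ∫_{(0,2a]} ρ(t) sin(ω_m t) dt` and `J_c(m) = ∫_{(0,2a]} ρ(t)(1 − cos ω_m t) dt` (`ω_m = πm/a`,
`ρ = weilArchDensity`).  For the structured (Gram-form) `Uq` tail (`WeilFormatCDeflatedFarCouplingGram`,
`WeilFormatCFamilyGram`) their MAIN PARTS join the elementary families `{1/m^e, log m/m^e}` and only the deviations are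
perturbation families with crude boxes.  This file gives the first-order asymptotics with explicit constants:

* `abs_setIntegral_weilArchDensity_mul_sin_sub_le` — `|J_s(m) − π/4| ≤ a(1+ρ(2a))/(πm)` for `m ≥ 1`
  (`abs_smoothMode_sub_le` transported through `setIntegral_weilArchDensity_mul_sin`);
* `abs_reDigammaQuarter_sub_log_le` — `|Re ψ(¼ + iω/2) − log(|ω|/2)| ≤ 12/(5ω²)` for `|ω| ≥ 2` (from the tree's second-order
  vertical Stirling bound `abs_re_digamma_sub_log_norm_add_re_le`);
* `tsum_exp_mul_digammaTerm_div_two_eq` — `Σ_k e^{−2al_k} f_{l_k}(ω)/2 = Σ_k e^{−2al_k}/l_k − Σ_k e^{−2al_k} l_k/(l_k² + ω²)`,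
  and `0 ≤ Σ_k e^{−2al_k} l_k/(l_k² + ω²) ≤ ρ(a)/(a ω²)` (`l·e^{−al} ≤ 1/a`, `Σ_k e^{−al_k} = ρ(a)`);
* **`abs_setIntegral_weilArchDensity_mul_one_sub_cos_sub_le`** —
  `|J_c(m) − (½ log(|ω_m|/2) − ½ψ(¼) − Σ_k e^{−2al_k}/l_k)| ≤ (6/5 + ρ(a)/a)/ω_m²` for `|ω_m| ≥ 2`, and the `log m` form
  for natural `m`;
* `tsum_exp_div_node_sub_sum_le` — the constant `Σ_k e^{−2al_k}/l_k` from its partial sums, for the (E) boxes: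
  `0 ≤ Σ_k − Σ_{k<K} ≤ 2(ρ(2a) − Σ_{k<K} e^{−2al_k})`.

Standard axioms; no definitions; no RH claim.
-/

set_option autoImplicit false
-- `Summit.RiemannHypothesis.RiemannHypothesis.…` is the layout-mandated namespace (summit = problem name).
set_option linter.dupNamespace false

noncomputable section

open Complex Filter Set MeasureTheory
open scoped Real Topology

namespace Summit.RiemannHypothesis.RiemannHypothesis.Theorems.WeilFormatC

open Literature.NumberTheory.LFunctions Literature.NumberTheory.LFunctions.Yoshida1992
  Literature.Analysis.SpecialFunctions

variable {a : ℝ}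

/-! ## `J_s(m) = π/4 + O(1/m)` -/

/-- **First-order asymptotics of the sine family**: `|∫_{(0,2a]} ρ(t) sin(ω_m t) dt − π/4| ≤ a(1+ρ(2a))/(πm)` for
natural `m ≥ 1`. -/
theorem abs_setIntegral_weilArchDensity_mul_sin_sub_le (ha : 0 < a) {m : ℕ} (hm : 1 ≤ m) :
    |(∫ t in Ioc 0 (2 * a), weilArchDensity t * Real.sin (π * m / a * t)) - π / 4|
      ≤ a * (1 + weilArchDensity (2 * a)) / (π * m) := by
  have h := setIntegral_weilArchDensity_mul_sin ha (m : ℤ)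
  have hcast : ((m : ℤ) : ℝ) = (m : ℝ) := Int.cast_natCast m
  rw [hcast] at h
  rw [h]
  have h2 := abs_smoothMode_sub_le ha hm
  have hfreq : freq a (m : ℤ) = π * m / a := by simp [freq]
  simp only [archExpSumSin, hfreq] at h2
  exact h2

/-! ## `Re ψ(¼ + iω/2) = log(|ω|/2) + O(1/ω²)` -/

/-- **Second-order Stirling on the quarter line, explicit**: `|Re ψ(¼ + iω/2) − log(ω/2)| ≤ 12/(5ω²)` for `ω ≥ 2`. -/
theorem abs_reDigammaQuarter_sub_log_le_of_two_le {ω : ℝ} (hω : 2 ≤ ω) :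
    |reDigammaQuarter ω - Real.log (ω / 2)| ≤ 12 / (5 * ω ^ 2) := by
  set y : ℝ := ω / 2 with hy
  have hy1 : 1 ≤ y := by rw [hy]; linarith
  have hy0 : 0 < y := by linarith
  have hωy : ω = 2 * y := by rw [hy]; ring
  set w : ℂ := 1 / 4 + (ω : ℂ) / 2 * I with hw
  have hwre : w.re = 1 / 4 := by simp [hw]
  have hwim : w.im = y := by simp [hw, hy]
  have hX : reDigammaQuarter ω = (Complex.digamma w).re := rfl
  -- the tree's second-order bound
  have hS := Literature.NumberTheory.LFunctions.Complex.abs_re_digamma_sub_log_norm_add_re_le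
    (w := w) (by rw [hwre]; norm_num) (by rw [hwim]; exact hy0.ne')
  rw [hwim, abs_of_pos hy0] at hS
  -- `‖w‖² = 1/16 + y²`
  have hnorm2 : ‖w‖ ^ 2 = 1 / 16 + y ^ 2 := by
    rw [← Complex.normSq_eq_norm_sq, Complex.normSq_apply, hwre, hwim]; ring
  have hnorm_pos : 0 < ‖w‖ := by
    rcases (norm_nonneg w).lt_or_eq with h | h
    · exact h
    · exfalso
      have : ‖w‖ ^ 2 = 0 := by rw [← h]; ring
      rw [hnorm2] at this
      nlinarith
  -- `0 ≤ log ‖w‖ − log y ≤ 1/(32y²)`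
  have hL : Real.log ‖w‖ - Real.log y = Real.log (1 + 1 / (16 * y ^ 2)) / 2 := by
    have e1 : 2 * (Real.log ‖w‖ - Real.log y) = Real.log (‖w‖ ^ 2) - Real.log (y ^ 2) := by
      rw [Real.log_pow, Real.log_pow]; push_cast; ring
    have e2 : Real.log (‖w‖ ^ 2) - Real.log (y ^ 2) = Real.log (‖w‖ ^ 2 / y ^ 2) :=
      (Real.log_div (by positivity) (by positivity)).symm
    have e3 : ‖w‖ ^ 2 / y ^ 2 = 1 + 1 / (16 * y ^ 2) := by
      rw [hnorm2]; field_simp; ring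
    rw [e2, e3] at e1
    linarith
  have hL0 : 0 ≤ Real.log ‖w‖ - Real.log y := by
    rw [hL]; exact div_nonneg (Real.log_nonneg (by simp; positivity)) (by norm_num)
  have hL1 : Real.log ‖w‖ - Real.log y ≤ 1 / (32 * y ^ 2) := by
    rw [hL]
    have := Real.log_le_sub_one_of_pos (x := 1 + 1 / (16 * y ^ 2)) (by positivity)
    have e : (1 + 1 / (16 * y ^ 2) - 1) / 2 = 1 / (32 * y ^ 2) := by field_simp; ring
    rw [← e]
    exact div_le_div_of_nonneg_right this (by norm_num)
  -- `Re 1/(2w) = 2/(1 + 16y²) ∈ [0, 1/(8y²)]`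
  have h2w : 2 * w = ⟨1 / 2, 2 * y⟩ := by
    apply Complex.ext
    · simp [hw]; norm_num
    · simp [hw, hy]
  have hre : (1 / (2 * w)).re = 2 / (1 + 16 * y ^ 2) := by
    rw [h2w, one_div, Complex.inv_re, Complex.normSq_mk]
    field_simp
    ring
  have hre0 : 0 ≤ (1 / (2 * w)).re := by rw [hre]; positivity
  have hre1 : (1 / (2 * w)).re ≤ 1 / (8 * y ^ 2) := by
    rw [hre, div_le_div_iff₀ (by positivity) (by positivity)]
    nlinarith
  -- assemble
  have hy3 : 1 / (6 * y ^ 3) ≤ 1 / (6 * y ^ 2) := by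
    apply one_div_le_one_div_of_le (by positivity)
    have : y ^ 2 ≤ y ^ 3 := by nlinarith
    linarith
  have hpi : π / (12 * y ^ 2) ≤ 3.15 / (12 * y ^ 2) :=
    div_le_div_of_nonneg_right Real.pi_lt_d2.le (by positivity)
  have key : |(Complex.digamma w).re - Real.log y| ≤ 3 / (5 * y ^ 2) := by
    have e : (Complex.digamma w).re - Real.log y
        = ((Complex.digamma w).re - Real.log ‖w‖ + (1 / (2 * w)).re) + (Real.log ‖w‖ - Real.log y)
          - (1 / (2 * w)).re := by ring
    rw [e]
    refine (abs_sub _ _).trans ((add_le_add (abs_add_le _ _) le_rfl).trans ?_)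
    rw [abs_of_nonneg hL0, abs_of_nonneg hre0]
    have hy2 : 0 < y ^ 2 := by positivity
    have ediv : ∀ c k : ℝ, c / (k * y ^ 2) = (c / k) / y ^ 2 := fun c k ↦ by rw [div_div]
    have etot : 1 / (6 * y ^ 2) + 3.15 / (12 * y ^ 2) + 1 / (32 * y ^ 2) + 1 / (8 * y ^ 2) ≤ 3 / (5 * y ^ 2) := by
      rw [ediv 1 6, ediv 3.15 12, ediv 1 32, ediv 1 8, ediv 3 5, ← add_div, ← add_div, ← add_div]
      exact div_le_div_of_nonneg_right (by norm_num) hy2.le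
    linarith [hS, hL1, hre1, hy3, hpi, etot]
  rw [hX, show (12 : ℝ) / (5 * ω ^ 2) = 3 / (5 * y ^ 2) by rw [hωy]; ring]
  exact key

/-- `Re ψ(¼ + i|ω|/2) = Re ψ(¼ + iω/2)` (evenness). -/
theorem reDigammaQuarter_abs (ω : ℝ) : reDigammaQuarter |ω| = reDigammaQuarter ω := by
  rcases le_or_gt 0 ω with h | h
  · rw [abs_of_nonneg h]
  · rw [abs_of_neg h, reDigammaQuarter_even]

/-- **`|Re ψ(¼ + iω/2) − log(|ω|/2)| ≤ 12/(5ω²)` for `|ω| ≥ 2`.** -/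
theorem abs_reDigammaQuarter_sub_log_le {ω : ℝ} (hω : 2 ≤ |ω|) :
    |reDigammaQuarter ω - Real.log (|ω| / 2)| ≤ 12 / (5 * ω ^ 2) := by
  have h := abs_reDigammaQuarter_sub_log_le_of_two_le hω
  rw [reDigammaQuarter_abs, sq_abs] at h
  exact h

/-! ## The node sums of the cosine family -/

/-- `l · e^{−al} ≤ 1/a` for `a > 0`, `l` real. -/
theorem mul_exp_neg_mul_le_inv (ha : 0 < a) (l : ℝ) : l * Real.exp (-(a * l)) ≤ 1 / a := by
  have h1 : a * l + 1 ≤ Real.exp (a * l) := Real.add_one_le_exp (a * l)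
  have h2 : a * l ≤ Real.exp (a * l) := by linarith
  rw [Real.exp_neg, le_div_iff₀ ha]
  have hexp : 0 < Real.exp (a * l) := Real.exp_pos _
  calc l * (Real.exp (a * l))⁻¹ * a = (a * l) / Real.exp (a * l) := by rw [div_eq_mul_inv]; ring
    _ ≤ Real.exp (a * l) / Real.exp (a * l) := div_le_div_of_nonneg_right h2 hexp.le
    _ = 1 := div_self hexp.ne'

/-- `Σ_k e^{−2al_k}/l_k` is summable (`a > 0`). -/
theorem summable_exp_div_node (ha : 0 < a) :
    Summable (fun k : ℕ ↦ Real.exp (-(2 * a * digammaNode k)) / digammaNode k) := by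
  have h := summable_exp_neg_mul_of_bounded ha (b := fun k ↦ 1 / digammaNode k) (C := 2) fun k ↦ by
    have hl := digammaNode_pos k
    have hl2 := one_half_le_digammaNode k
    rw [abs_of_pos (by positivity), div_le_iff₀ hl]; linarith
  exact h.congr fun k ↦ by ring

/-- `Σ_k e^{−2al_k} l_k/(l_k² + ω²)` is summable (`a > 0`). -/
theorem summable_exp_mul_node_div (ha : 0 < a) (ω : ℝ) :
    Summable (fun k : ℕ ↦ Real.exp (-(2 * a * digammaNode k)) * (digammaNode k / (digammaNode k ^ 2 + ω ^ 2))) :=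
  summable_exp_neg_mul_of_bounded ha (C := 2) fun k ↦ by
    have hl := digammaNode_pos k
    have hl2 := one_half_le_digammaNode k
    rw [abs_of_nonneg (by positivity)]
    calc digammaNode k / (digammaNode k ^ 2 + ω ^ 2) ≤ digammaNode k / digammaNode k ^ 2 :=
          div_le_div_of_nonneg_left hl.le (by positivity) (by nlinarith [sq_nonneg ω])
      _ = 1 / digammaNode k := by rw [sq]; field_simp
      _ ≤ 2 := by rw [div_le_iff₀ hl]; linarith

/-- **The cosine node sum, split**: `Σ_k e^{−2al_k} f_{l_k}(ω)/2 = Σ_k e^{−2al_k}/l_k − Σ_k e^{−2al_k} l_k/(l_k² + ω²)`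
(`f_l(ω) = 2ω²/(l(l² + ω²)) = 2/l − 2l/(l² + ω²)`). -/
theorem tsum_exp_mul_digammaTerm_div_two_eq (ha : 0 < a) (ω : ℝ) :
    ∑' k : ℕ, Real.exp (-(2 * a * digammaNode k)) * (digammaTerm (digammaNode k) ω / 2)
      = (∑' k : ℕ, Real.exp (-(2 * a * digammaNode k)) / digammaNode k)
        - ∑' k : ℕ, Real.exp (-(2 * a * digammaNode k)) * (digammaNode k / (digammaNode k ^ 2 + ω ^ 2)) := by
  rw [← (summable_exp_div_node ha).tsum_sub (summable_exp_mul_node_div ha ω)]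
  refine tsum_congr fun k ↦ ?_
  have hl := digammaNode_pos k
  rw [digammaTerm_eq hl]
  ring

/-- `0 ≤ Σ_k e^{−2al_k} l_k/(l_k² + ω²)`. -/
theorem tsum_exp_mul_node_div_nonneg (a ω : ℝ) :
    0 ≤ ∑' k : ℕ, Real.exp (-(2 * a * digammaNode k)) * (digammaNode k / (digammaNode k ^ 2 + ω ^ 2)) :=
  tsum_nonneg fun k ↦ by have := digammaNode_pos k; positivity

/-- **`Σ_k e^{−2al_k} l_k/(l_k² + ω²) ≤ ρ(a)/(a ω²)`** for `ω ≠ 0` (`ρ(a) = weilArchDensity a = Σ_k e^{−al_k}`;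
termwise `e^{−2al} l/(l² + ω²) ≤ e^{−al}·(l e^{−al})/ω² ≤ e^{−al}/(a ω²)`). -/
theorem tsum_exp_mul_node_div_le (ha : 0 < a) {ω : ℝ} (hω : ω ≠ 0) :
    ∑' k : ℕ, Real.exp (-(2 * a * digammaNode k)) * (digammaNode k / (digammaNode k ^ 2 + ω ^ 2))
      ≤ weilArchDensity a / (a * ω ^ 2) := by
  have hω2 : 0 < ω ^ 2 := by positivity
  have hρ := hasSum_exp_neg_digammaNode_mul (t := a) ha
  have hρ' : HasSum (fun k : ℕ ↦ Real.exp (-(digammaNode k * a)) * (1 / (a * ω ^ 2)))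
      (weilArchDensity a * (1 / (a * ω ^ 2))) := hρ.mul_right _
  have hle : ∀ k, Real.exp (-(2 * a * digammaNode k)) * (digammaNode k / (digammaNode k ^ 2 + ω ^ 2))
      ≤ Real.exp (-(digammaNode k * a)) * (1 / (a * ω ^ 2)) := by
    intro k
    have hl := digammaNode_pos k
    have h1 : digammaNode k / (digammaNode k ^ 2 + ω ^ 2) ≤ digammaNode k / ω ^ 2 :=
      div_le_div_of_nonneg_left hl.le hω2 (by nlinarith [sq_nonneg (digammaNode k)])
    have h2 : Real.exp (-(2 * a * digammaNode k)) = Real.exp (-(digammaNode k * a)) * Real.exp (-(a * digammaNode k)) := by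
      rw [← Real.exp_add]; congr 1; ring
    have h3 := mul_exp_neg_mul_le_inv ha (digammaNode k)
    have hexp : 0 < Real.exp (-(digammaNode k * a)) := Real.exp_pos _
    calc Real.exp (-(2 * a * digammaNode k)) * (digammaNode k / (digammaNode k ^ 2 + ω ^ 2))
        ≤ Real.exp (-(2 * a * digammaNode k)) * (digammaNode k / ω ^ 2) :=
          mul_le_mul_of_nonneg_left h1 (Real.exp_pos _).le
      _ = Real.exp (-(digammaNode k * a)) * ((digammaNode k * Real.exp (-(a * digammaNode k))) / ω ^ 2) := by
          rw [h2]; ring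
      _ ≤ Real.exp (-(digammaNode k * a)) * ((1 / a) / ω ^ 2) :=
          mul_le_mul_of_nonneg_left (div_le_div_of_nonneg_right h3 hω2.le) hexp.le
      _ = Real.exp (-(digammaNode k * a)) * (1 / (a * ω ^ 2)) := by rw [div_div]
  calc ∑' k : ℕ, Real.exp (-(2 * a * digammaNode k)) * (digammaNode k / (digammaNode k ^ 2 + ω ^ 2))
      ≤ ∑' k : ℕ, Real.exp (-(digammaNode k * a)) * (1 / (a * ω ^ 2)) :=
        (summable_exp_mul_node_div ha ω).tsum_le_tsum hle hρ'.summable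
    _ = weilArchDensity a * (1 / (a * ω ^ 2)) := hρ'.tsum_eq
    _ = weilArchDensity a / (a * ω ^ 2) := by rw [mul_one_div]

/-! ## `J_c(m) = ½ log|ω_m| + κ(a) + O(1/ω_m²)` -/

/-- **First-order asymptotics of the cosine family**: for `a > 0` and `|ω_m| ≥ 2` (`ω_m = πm/a`),
`|∫_{(0,2a]} ρ(t)(1 − cos ω_m t) dt − (½ log(|ω_m|/2) − ½ Re ψ(¼) − Σ_k e^{−2al_k}/l_k)| ≤ (6/5 + ρ(a)/a)/ω_m²`. -/
theorem abs_setIntegral_weilArchDensity_mul_one_sub_cos_sub_le (ha : 0 < a) {m : ℤ} (hm : 2 ≤ |π * m / a|) :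
    |(∫ t in Ioc 0 (2 * a), weilArchDensity t * (1 - Real.cos (π * m / a * t)))
        - (Real.log (|π * m / a| / 2) / 2 - reDigammaQuarter 0 / 2
            - ∑' k : ℕ, Real.exp (-(2 * a * digammaNode k)) / digammaNode k)|
      ≤ (6 / 5 + weilArchDensity a / a) / (π * m / a) ^ 2 := by
  set ω : ℝ := π * m / a with hω
  have hω0 : ω ≠ 0 := by
    intro h; rw [h, abs_zero] at hm; linarith
  have hω2 : 0 < ω ^ 2 := by positivity
  rw [setIntegral_weilArchDensity_mul_one_sub_cos ha m, ← hω, tsum_exp_mul_digammaTerm_div_two_eq ha ω]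
  have hX := abs_reDigammaQuarter_sub_log_le hm
  have hR0 := tsum_exp_mul_node_div_nonneg a ω
  have hR1 := tsum_exp_mul_node_div_le ha hω0
  set R := ∑' k : ℕ, Real.exp (-(2 * a * digammaNode k)) * (digammaNode k / (digammaNode k ^ 2 + ω ^ 2)) with hR
  set D := ∑' k : ℕ, Real.exp (-(2 * a * digammaNode k)) / digammaNode k with hD
  have e : (reDigammaQuarter ω - reDigammaQuarter 0) / 2 - (D - R)
      - (Real.log (|ω| / 2) / 2 - reDigammaQuarter 0 / 2 - D)
      = (reDigammaQuarter ω - Real.log (|ω| / 2)) / 2 + R := by ring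
  rw [e]
  calc |(reDigammaQuarter ω - Real.log (|ω| / 2)) / 2 + R|
      ≤ |(reDigammaQuarter ω - Real.log (|ω| / 2)) / 2| + |R| := abs_add_le _ _
    _ = |reDigammaQuarter ω - Real.log (|ω| / 2)| / 2 + R := by
        rw [abs_div, abs_two, abs_of_nonneg hR0]
    _ ≤ 12 / (5 * ω ^ 2) / 2 + weilArchDensity a / (a * ω ^ 2) := by gcongr
    _ = (6 / 5 + weilArchDensity a / a) / ω ^ 2 := by
        field_simp
        ring

/-- **The `log m` form for natural `m`**: for `a > 0`, `m ≥ 1` with `πm/a ≥ 2`,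
`|J_c(m) − (½ log m + ½ log(π/(2a)) − ½ Re ψ(¼) − Σ_k e^{−2al_k}/l_k)| ≤ (6/5 + ρ(a)/a)·a²/(π²m²)`. -/
theorem abs_setIntegral_weilArchDensity_mul_one_sub_cos_sub_log_le (ha : 0 < a) {m : ℕ} (hm : 1 ≤ m)
    (hm2 : 2 ≤ π * m / a) :
    |(∫ t in Ioc 0 (2 * a), weilArchDensity t * (1 - Real.cos (π * m / a * t)))
        - (Real.log m / 2 + Real.log (π / (2 * a)) / 2 - reDigammaQuarter 0 / 2
            - ∑' k : ℕ, Real.exp (-(2 * a * digammaNode k)) / digammaNode k)|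
      ≤ (6 / 5 + weilArchDensity a / a) * a ^ 2 / (π ^ 2 * (m : ℝ) ^ 2) := by
  have hm0 : (0 : ℝ) < m := by exact_mod_cast hm
  have hpos : 0 < π * m / a := by positivity
  have h := abs_setIntegral_weilArchDensity_mul_one_sub_cos_sub_le ha (m := (m : ℤ))
    (by rw [Int.cast_natCast, abs_of_pos hpos]; exact hm2)
  rw [Int.cast_natCast, abs_of_pos hpos] at h
  have hlog : Real.log (π * m / a / 2) = Real.log m + Real.log (π / (2 * a)) := by
    rw [show π * m / a / 2 = m * (π / (2 * a)) by ring, Real.log_mul hm0.ne' (by positivity)]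
  rw [hlog] at h
  have e1 : (Real.log m + Real.log (π / (2 * a))) / 2 = Real.log m / 2 + Real.log (π / (2 * a)) / 2 := by ring
  have e2 : (6 / 5 + weilArchDensity a / a) / (π * m / a) ^ 2
      = (6 / 5 + weilArchDensity a / a) * a ^ 2 / (π ^ 2 * (m : ℝ) ^ 2) := by
    field_simp
  rw [e1, e2] at h
  exact h

/-! ## The constant `Σ_k e^{−2al_k}/l_k` from partial sums -/

/-- **Enclosure of `Σ_k e^{−2al_k}/l_k` by partial sums**: for every `K`,
`0 ≤ Σ_k e^{−2al_k}/l_k − Σ_{k<K} e^{−2al_k}/l_k ≤ 2·(ρ(2a) − Σ_{k<K} e^{−2al_k})` (`ρ(2a) = Σ_k e^{−2al_k}`, `1/l_k ≤ 2`). -/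
theorem tsum_exp_div_node_sub_sum_le (ha : 0 < a) (K : ℕ) :
    0 ≤ (∑' k : ℕ, Real.exp (-(2 * a * digammaNode k)) / digammaNode k)
        - ∑ k ∈ Finset.range K, Real.exp (-(2 * a * digammaNode k)) / digammaNode k
    ∧ (∑' k : ℕ, Real.exp (-(2 * a * digammaNode k)) / digammaNode k)
        - ∑ k ∈ Finset.range K, Real.exp (-(2 * a * digammaNode k)) / digammaNode k
      ≤ 2 * (weilArchDensity (2 * a) - ∑ k ∈ Finset.range K, Real.exp (-(2 * a * digammaNode k))) := by
  have hs := summable_exp_div_node ha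
  have hρ : HasSum (fun k : ℕ ↦ Real.exp (-(2 * a * digammaNode k))) (weilArchDensity (2 * a)) := by
    have h := hasSum_exp_neg_digammaNode_mul (t := 2 * a) (by positivity)
    refine h.congr_fun fun k ↦ ?_
    ring_nf
  have hse := hρ.summable
  -- tails
  have ht1 : (∑' k : ℕ, Real.exp (-(2 * a * digammaNode k)) / digammaNode k)
      - ∑ k ∈ Finset.range K, Real.exp (-(2 * a * digammaNode k)) / digammaNode k
      = ∑' k : ℕ, Real.exp (-(2 * a * digammaNode (k + K))) / digammaNode (k + K) := by
    rw [← hs.sum_add_tsum_nat_add K]; ring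
  have ht2 : weilArchDensity (2 * a) - ∑ k ∈ Finset.range K, Real.exp (-(2 * a * digammaNode k))
      = ∑' k : ℕ, Real.exp (-(2 * a * digammaNode (k + K))) := by
    rw [← hρ.tsum_eq, ← hse.sum_add_tsum_nat_add K]; ring
  have hsK : Summable fun k : ℕ ↦ Real.exp (-(2 * a * digammaNode (k + K))) / digammaNode (k + K) :=
    (summable_nat_add_iff K).2 hs
  have hseK : Summable fun k : ℕ ↦ Real.exp (-(2 * a * digammaNode (k + K))) :=
    (summable_nat_add_iff K).2 hse
  rw [ht1, ht2]
  constructor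
  · exact tsum_nonneg fun k ↦ by have := digammaNode_pos (k + K); positivity
  · rw [← tsum_mul_left]
    refine hsK.tsum_le_tsum (fun k ↦ ?_) (hseK.mul_left 2)
    have hl := digammaNode_pos (k + K)
    have hl2 := one_half_le_digammaNode (k + K)
    have hexp : 0 < Real.exp (-(2 * a * digammaNode (k + K))) := Real.exp_pos _
    rw [div_le_iff₀ hl]
    nlinarith

end Summit.RiemannHypothesis.RiemannHypothesis.Theorems.WeilFormatC
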